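import Literature.NumberTheory.Transcendental.MasserThmIParams
import Literature.NumberTheory.Transcendental.OnePeriods
import HarnessLib

/-!
# Masser 1975, Lemma 2.2 — small values of `Aω₁² + Bω₁ω₂ + Cω₂²`

Support for the book's own proof (Ch. II) of
`Literature.NumberTheory.Transcendental.masser_ellipticPeriods` (Masser 1975, Theorem II).

D. W. Masser, *Elliptic Functions and Transcendence*, LNM 437 (1975), Ch. II §2.2, Lemma 2.2
(pp. 16–17): for a lattice with algebraic invariants and without complex multiplication and for
`X > c₁` there are integers `A, B, C` of height `H` with
(i) `e^{-(log X)^4} < |Aω₁² + Bω₁ω₂ + Cω₂²| < X⁻¹`, (ii) `e^{(log X)^{1/4}} < H < c₂X²`,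
(iii) `|C| > c₃H`. The proof is the Box Principle plus Theorem I with `ε = ½`
(`Masser1975.masser_thmI_quadratic`).

* `hasCM_of_quadratic` — an integer quadratic relation for `τ = ω₂/ω₁` gives complex
  multiplication (so, without CM, `Aω₁² + Bω₁ω₂ + Cω₂² ≠ 0` for `(A,B,C) ≠ 0`);
* `exists_small_periodForm` — the Box Principle with explicit height `≤ c X²`;
* `thmI_root`, `quadForm_lower` — Theorem I with a constant, for every root of every integer
  quadratic (reduction to exact height + the finitely many quadratics of small height);
* `masser_lemma_2_2` — Lemma 2.2.

Everything here is proved; no named facts.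

## References

* D. W. Masser, *Elliptic Functions and Transcendence*, Lecture Notes in Math. 437, Springer 1975,
  Ch. II §2.2, Lemma 2.2 (pp. 16–17). [Masser1975]
-/

noncomputable section

open Complex Metric Set Real Filter

namespace Literature.NumberTheory.Transcendental.Masser1975

/-! ### Quadratic relations for `τ` mean complex multiplication -/

/-- `τ = ω₂/ω₁` is not real. [folklore] -/
theorem im_tau_ne_zero (L : PeriodPair) : (L.ω₂ / L.ω₁).im ≠ 0 := by
  intro him
  have hω₁ : L.ω₁ ≠ 0 := by simpa using basis_ne_zero L 0
  set r : ℝ := (L.ω₂ / L.ω₁).re with hr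
  have hτ : L.ω₂ / L.ω₁ = (r : ℂ) := Complex.ext (by simp [hr]) (by simp [him])
  have hω₂ : L.ω₂ = (r : ℂ) * L.ω₁ := by rw [← hτ, div_mul_cancel₀ _ hω₁]
  have h := LinearIndependent.pair_iff.mp L.indep r (-1) (by
    simp only [Complex.real_smul, neg_smul, one_smul]
    rw [hω₂]; ring)
  norm_num at h

/-- If `A + Bτ + Cτ² = 0` with integers `(A, B, C) ≠ 0`, `τ = ω₂/ω₁`, then the lattice has
complex multiplication (by `Cτ`). [folklore] -/
theorem hasCM_of_quadratic (L : PeriodPair) {A B C : ℤ} (h0 : (A, B, C) ≠ (0, 0, 0))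
    (h : (A : ℂ) + (B : ℂ) * (L.ω₂ / L.ω₁) + (C : ℂ) * (L.ω₂ / L.ω₁) ^ 2 = 0) : L.HasCM := by
  have hω₁ : L.ω₁ ≠ 0 := by simpa using basis_ne_zero L 0
  set τ := L.ω₂ / L.ω₁ with hτ
  have him : τ.im ≠ 0 := im_tau_ne_zero L
  have hτω : τ * L.ω₁ = L.ω₂ := by rw [hτ, div_mul_cancel₀ _ hω₁]
  clear_value τ
  -- `C ≠ 0`
  have hC : C ≠ 0 := by
    intro hC
    subst hC
    simp only [Int.cast_zero, zero_mul, add_zero] at h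
    have hB : B = 0 := by
      by_contra hB
      have := congrArg Complex.im h
      simp only [Complex.add_im, Complex.intCast_im, Complex.mul_im, Complex.intCast_re, zero_mul,
        add_zero, zero_add, Complex.zero_im, mul_eq_zero, Int.cast_eq_zero] at this
      exact this.elim hB him
    subst hB
    simp only [Int.cast_zero, zero_mul, add_zero, Int.cast_eq_zero] at h
    subst h
    exact h0 rfl
  refine ⟨(C : ℂ) * τ, fun n hn => ?_, fun l hl => ?_⟩
  · have := congrArg Complex.im hn
    simp only [Complex.mul_im, Complex.intCast_re, Complex.intCast_im, zero_mul, add_zero,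
      mul_eq_zero, Int.cast_eq_zero] at this
    exact this.elim hC him
  · obtain ⟨p, q, rfl⟩ := PeriodPair.mem_lattice.mp hl
    have hCτ2 : (C : ℂ) * τ ^ 2 = -(A : ℂ) - (B : ℂ) * τ := by linear_combination h
    refine PeriodPair.mem_lattice.mpr ⟨-(q * A), C * p - q * B, ?_⟩
    push_cast
    have : (C : ℂ) * τ * ((p : ℂ) * L.ω₁ + (q : ℂ) * L.ω₂) =
        (C : ℂ) * (p : ℂ) * (τ * L.ω₁) + (q : ℂ) * ((C : ℂ) * τ ^ 2) * L.ω₁ := by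
      rw [← hτω]; ring
    rw [this, hCτ2, hτω]
    linear_combination ((q : ℂ) * (B : ℂ)) * hτω

/-- Without complex multiplication `A + Bτ + Cτ² ≠ 0` and `Aω₁² + Bω₁ω₂ + Cω₂² ≠ 0` for
`(A, B, C) ≠ 0`. [cite: Masser1975, §2.2 (proof of Lemma 2.2, uses "no complex multiplication")] -/
theorem periodForm_ne_zero (L : PeriodPair) (hCM : ¬ L.HasCM) {v : ℤ × ℤ × ℤ} (hv : v ≠ 0) :
    periodForm L v ≠ 0 := by
  intro h
  have hω₁ : L.ω₁ ≠ 0 := by simpa using basis_ne_zero L 0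
  apply hCM
  refine hasCM_of_quadratic L (A := v.1) (B := v.2.1) (C := v.2.2) (fun h0 => hv ?_) ?_
  · simp only [Prod.mk.injEq] at h0
    exact Prod.ext h0.1 (Prod.ext h0.2.1 h0.2.2)
  · have : periodForm L v = L.ω₁ ^ 2 * ((v.1 : ℂ) + (v.2.1 : ℂ) * (L.ω₂ / L.ω₁) +
        (v.2.2 : ℂ) * (L.ω₂ / L.ω₁) ^ 2) := by
      unfold periodForm; field_simp
    rw [this] at h
    exact (mul_eq_zero.mp h).resolve_left (pow_ne_zero 2 hω₁)

/-! ### The Box Principle with explicit height -/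

/-- The size constant `W = |ω₁|² + |ω₁||ω₂| + |ω₂|²` (`|Aω₁² + Bω₁ω₂ + Cω₂²| ≤ H·W`). [folklore] -/
def Wc (L : PeriodPair) : ℝ := ‖L.ω₁‖ ^ 2 + ‖L.ω₁‖ * ‖L.ω₂‖ + ‖L.ω₂‖ ^ 2

/-- `0 ≤ W`. [folklore] -/
theorem Wc_nonneg (L : PeriodPair) : 0 ≤ Wc L := by unfold Wc; positivity

/-- The height `H = max(|A|, |B|, |C|)` of an integer triple. [cite: Masser1975, Lemma 2.2] -/
def hgt (v : ℤ × ℤ × ℤ) : ℤ := max |v.1| (max |v.2.1| |v.2.2|)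

/-- `0 ≤ H`. [folklore] -/
theorem hgt_nonneg (v : ℤ × ℤ × ℤ) : 0 ≤ hgt v := le_max_of_le_left (abs_nonneg _)

/-- The coordinates are bounded by the height. [folklore] -/
theorem abs_le_hgt (v : ℤ × ℤ × ℤ) : |v.1| ≤ hgt v ∧ |v.2.1| ≤ hgt v ∧ |v.2.2| ≤ hgt v :=
  ⟨le_max_left _ _, (le_max_left _ _).trans (le_max_right _ _), (le_max_right _ _).trans (le_max_right _ _)⟩

/-- `H ≥ 1` for `v ≠ 0`. [folklore] -/
theorem one_le_hgt {v : ℤ × ℤ × ℤ} (hv : v ≠ 0) : 1 ≤ hgt v := by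
  by_contra h
  push Not at h
  obtain ⟨h1, h2, h3⟩ := abs_le_hgt v
  apply hv
  have e1 : v.1 = 0 := abs_nonpos_iff.mp (by omega)
  have e2 : v.2.1 = 0 := abs_nonpos_iff.mp (by omega)
  have e3 : v.2.2 = 0 := abs_nonpos_iff.mp (by omega)
  exact Prod.ext e1 (Prod.ext e2 e3)

/-- `|Aω₁² + Bω₁ω₂ + Cω₂²| ≤ H · W`. [folklore] -/
theorem norm_periodForm_le_hgt (L : PeriodPair) (v : ℤ × ℤ × ℤ) :
    ‖periodForm L v‖ ≤ (hgt v : ℝ) * Wc L := by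
  obtain ⟨h1, h2, h3⟩ := abs_le_hgt v
  exact norm_periodForm_le L v (by rw [← Int.cast_abs]; exact_mod_cast h1)
    (by rw [← Int.cast_abs]; exact_mod_cast h2) (by rw [← Int.cast_abs]; exact_mod_cast h3)

/-- **The Box Principle** (explicit): for `X ≥ 1` there is an integer triple `v ≠ 0` of height
`≤ (4WX + 3)² + 1` with `|Aω₁² + Bω₁ω₂ + Cω₂²| < X⁻¹`.
[cite: Masser1975, Lemma 2.2 (proof: "This square may be divided into at most c₅T²X² smaller disjoint squares of side ½X⁻¹")] -/
theorem exists_small_periodForm (L : PeriodPair) {X : ℝ} (hX : 1 ≤ X) :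
    ∃ v : ℤ × ℤ × ℤ, v ≠ 0 ∧ (hgt v : ℝ) ≤ (4 * Wc L * X + 3) ^ 2 + 1 ∧ ‖periodForm L v‖ < X⁻¹ := by
  set W := Wc L with hW
  have hW0 : 0 ≤ W := Wc_nonneg L
  have hX0 : 0 < X := by linarith
  set ε' : ℝ := X⁻¹ / 2 with hε'
  have hε'0 : 0 < ε' := by positivity
  set K : ℕ := ⌈(4 * W * X + 3) ^ 2⌉₊ with hK
  have hKge : (4 * W * X + 3) ^ 2 ≤ (K : ℝ) := Nat.le_ceil _
  have hKle : (K : ℝ) ≤ (4 * W * X + 3) ^ 2 + 1 := (Nat.ceil_lt_add_one (by positivity)).le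
  have h4WX : 0 ≤ 4 * W * X := by positivity
  have hK9 : (9 : ℝ) ≤ K := le_trans (by nlinarith) hKge
  have hK1 : (1 : ℝ) ≤ K := by linarith
  set s : Finset (ℤ × ℤ × ℤ) :=
    (Finset.Icc (0 : ℤ) K) ×ˢ ((Finset.Icc (0 : ℤ) K) ×ˢ (Finset.Icc (0 : ℤ) K)) with hs
  set B : ℤ := ⌈(K : ℝ) * W / ε'⌉ with hB
  set t : Finset (ℤ × ℤ) := (Finset.Icc (-B) B) ×ˢ (Finset.Icc (-B) B) with ht
  set f : ℤ × ℤ × ℤ → ℤ × ℤ := fun u =>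
    (⌊(periodForm L u).re / ε'⌋, ⌊(periodForm L u).im / ε'⌋) with hf
  have hB0 : (0 : ℝ) ≤ B := by
    rw [hB]; exact_mod_cast Int.ceil_nonneg (by positivity : (0 : ℝ) ≤ (K : ℝ) * W / ε')
  -- every point maps into a box
  have hmem_s : ∀ u ∈ s, (0 ≤ u.1 ∧ u.1 ≤ K) ∧ (0 ≤ u.2.1 ∧ u.2.1 ≤ K) ∧ (0 ≤ u.2.2 ∧ u.2.2 ≤ K) := by
    intro u hu
    simpa only [hs, Finset.mem_product, Finset.mem_Icc] using hu
  have hnormle : ∀ u ∈ s, ‖periodForm L u‖ ≤ K * W := by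
    intro u hu
    obtain ⟨⟨h1a, h1b⟩, ⟨h2a, h2b⟩, ⟨h3a, h3b⟩⟩ := hmem_s u hu
    refine norm_periodForm_le L u ?_ ?_ ?_ <;> rw [abs_le] <;> constructor
    · have : (0 : ℝ) ≤ u.1 := by exact_mod_cast h1a
      linarith
    · exact_mod_cast h1b
    · have : (0 : ℝ) ≤ u.2.1 := by exact_mod_cast h2a
      linarith
    · exact_mod_cast h2b
    · have : (0 : ℝ) ≤ u.2.2 := by exact_mod_cast h3a
      linarith
    · exact_mod_cast h3b
  have hcoord : ∀ x : ℝ, |x| ≤ K * W → ⌊x / ε'⌋ ∈ Finset.Icc (-B) B := by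
    intro x hx
    rw [abs_le] at hx
    rw [Finset.mem_Icc]
    constructor
    · rw [Int.le_floor, Int.cast_neg]
      have h1 : -((K : ℝ) * W / ε') ≤ x / ε' := by
        rw [← neg_div]; exact div_le_div_of_nonneg_right hx.1 hε'0.le
      exact le_trans (neg_le_neg (Int.le_ceil _)) h1
    · exact (Int.floor_le_floor (div_le_div_of_nonneg_right hx.2 hε'0.le)).trans (Int.floor_le_ceil _)
  have hmaps : ∀ u ∈ s, f u ∈ t := by
    intro u hu
    have hn := hnormle u hu
    simp only [ht, hf, Finset.mem_product]
    exact ⟨hcoord _ ((Complex.abs_re_le_norm _).trans hn), hcoord _ ((Complex.abs_im_le_norm _).trans hn)⟩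
  -- counting
  have hcard_s : s.card = (K + 1) ^ 3 := by
    simp only [hs, Finset.card_product, Int.card_Icc, sub_zero]
    have : ((K : ℤ) + 1).toNat = K + 1 := by
      rw [show ((K : ℤ) + 1) = ((K + 1 : ℕ) : ℤ) by push_cast; ring, Int.toNat_natCast]
    rw [this]; ring
  have hcard_t : t.card = (2 * B + 1).toNat ^ 2 := by
    simp only [ht, Finset.card_product, Int.card_Icc, sub_neg_eq_add]
    rw [show B + 1 + B = 2 * B + 1 by ring]; ring
  have hB0' : (0 : ℤ) ≤ 2 * B + 1 := by
    have : (0 : ℤ) ≤ B := by exact_mod_cast hB0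
    omega
  have hlt : t.card < s.card := by
    have hreal : ((2 * B + 1 : ℤ) : ℝ) ^ 2 < ((K : ℝ) + 1) ^ 3 := by
      have hBle : (B : ℝ) ≤ (K : ℝ) * W / ε' + 1 := by rw [hB]; exact (Int.ceil_lt_add_one _).le
      have hε'v : (K : ℝ) * W / ε' = 2 * K * W * X := by rw [hε']; field_simp
      rw [hε'v] at hBle
      have h1 : ((2 * B + 1 : ℤ) : ℝ) ≤ (K : ℝ) * (4 * W * X + 3) := by push_cast; nlinarith
      have h2 : (0 : ℝ) ≤ ((2 * B + 1 : ℤ) : ℝ) := by exact_mod_cast hB0'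
      calc ((2 * B + 1 : ℤ) : ℝ) ^ 2 ≤ ((K : ℝ) * (4 * W * X + 3)) ^ 2 := pow_le_pow_left₀ h2 h1 2
        _ = (K : ℝ) ^ 2 * (4 * W * X + 3) ^ 2 := by ring
        _ ≤ (K : ℝ) ^ 2 * K := mul_le_mul_of_nonneg_left hKge (by positivity)
        _ < ((K : ℝ) + 1) ^ 3 := by nlinarith
    have hcast : ((t.card : ℕ) : ℝ) < ((s.card : ℕ) : ℝ) := by
      rw [hcard_t, hcard_s]; push_cast
      have : (((2 * B + 1).toNat : ℕ) : ℝ) = ((2 * B + 1 : ℤ) : ℝ) := by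
        rw [← Int.cast_natCast, Int.toNat_of_nonneg hB0']
      rw [this]; exact hreal
    exact_mod_cast hcast
  -- pigeonhole
  obtain ⟨x, hx, y, hy, hxy, hfxy⟩ := Finset.exists_ne_map_eq_of_card_lt_of_maps_to hlt hmaps
  refine ⟨x - y, sub_ne_zero.mpr hxy, ?_, ?_⟩
  · -- height
    obtain ⟨⟨hx1a, hx1b⟩, ⟨hx2a, hx2b⟩, ⟨hx3a, hx3b⟩⟩ := hmem_s x hx
    obtain ⟨⟨hy1a, hy1b⟩, ⟨hy2a, hy2b⟩, ⟨hy3a, hy3b⟩⟩ := hmem_s y hy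
    have hh : hgt (x - y) ≤ K := by
      unfold hgt
      simp only [Prod.fst_sub, Prod.snd_sub]
      refine max_le (abs_le.mpr ⟨by omega, by omega⟩) (max_le (abs_le.mpr ⟨by omega, by omega⟩)
        (abs_le.mpr ⟨by omega, by omega⟩))
    calc (hgt (x - y) : ℝ) ≤ K := by exact_mod_cast hh
      _ ≤ _ := hKle
  · simp only [hf, Prod.mk.injEq] at hfxy
    have hre := Int.abs_sub_lt_one_of_floor_eq_floor hfxy.1
    have him := Int.abs_sub_lt_one_of_floor_eq_floor hfxy.2
    rw [← sub_div, abs_div, abs_of_pos hε'0, div_lt_one hε'0] at hre him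
    rw [periodForm_sub]
    calc ‖periodForm L x - periodForm L y‖
        ≤ |(periodForm L x - periodForm L y).re| + |(periodForm L x - periodForm L y).im| :=
          Complex.norm_le_abs_re_add_abs_im _
      _ = |(periodForm L x).re - (periodForm L y).re| + |(periodForm L x).im - (periodForm L y).im| := by
          simp only [Complex.sub_re, Complex.sub_im]
      _ < ε' + ε' := add_lt_add hre him
      _ = X⁻¹ := by rw [hε']; ring

/-! ### Theorem I with a constant, for every root of every integer quadratic -/

section ThmICor

/-- `α` satisfies the integer quadratic relation `A + Bα + Cα² = 0`. [folklore] -/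
def IsRel (α : ℂ) (A B C : ℤ) : Prop := (A : ℂ) + (B : ℂ) * α + (C : ℂ) * α ^ 2 = 0

/-- The completed square: `(2Cα + B)² = B² - 4AC` for a root. [folklore] -/
theorem sq_eq_disc {α : ℂ} {A B C : ℤ} (h : IsRel α A B C) :
    (2 * (C : ℂ) * α + B) ^ 2 = ((B ^ 2 - 4 * A * C : ℤ) : ℂ) := by
  unfold IsRel at h
  push_cast
  linear_combination (4 * (C : ℂ)) * h

/-- A complex number with a real square of the indicated sign. [folklore] -/
theorem im_eq_zero_of_sq_nonneg {w : ℂ} {D : ℝ} (hw : w ^ 2 = D) (hD : 0 ≤ D) : w.im = 0 := by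
  by_contra him
  have hre : (w ^ 2).im = 0 := by rw [hw]; simp
  have h2 : (w ^ 2).im = 2 * w.re * w.im := by rw [pow_two, Complex.mul_im]; ring
  rw [h2] at hre
  have hr0 : w.re = 0 := by
    rcases mul_eq_zero.mp hre with h | h
    · linarith
    · exact absurd h him
  have hsq : (w ^ 2).re = D := by rw [hw]; simp
  have : (w ^ 2).re = -(w.im ^ 2) := by rw [pow_two, Complex.mul_re, hr0]; ring
  have hpos : 0 < w.im ^ 2 := by positivity
  linarith

/-- A non-real number with a real square has a negative square. [folklore] -/
theorem sq_neg_of_im_ne_zero {w : ℂ} {D : ℝ} (hw : w ^ 2 = D) (him : w.im ≠ 0) : D < 0 := by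
  by_contra hD
  push Not at hD
  exact him (im_eq_zero_of_sq_nonneg hw hD)

/-- A root of a quadratic with negative discriminant is not real. [folklore] -/
theorem im_ne_zero_of_disc_neg {α : ℂ} {A B C : ℤ} (h : IsRel α A B C) (hd : B ^ 2 - 4 * A * C < 0) :
    α.im ≠ 0 := by
  intro hα
  have hsq := sq_eq_disc h
  have hw : (2 * (C : ℂ) * α + B).im = 0 := by simp [hα]
  -- a real number has a non-negative square
  have : (0 : ℝ) ≤ ((B ^ 2 - 4 * A * C : ℤ) : ℝ) := by
    have hre : ((2 * (C : ℂ) * α + B) ^ 2).re = ((B ^ 2 - 4 * A * C : ℤ) : ℝ) := by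
      rw [hsq, ← Complex.ofReal_intCast, Complex.ofReal_re]
    have hxr : ((2 * (C : ℂ) * α + B) ^ 2).re =
        (2 * (C : ℂ) * α + B).re ^ 2 - (2 * (C : ℂ) * α + B).im ^ 2 := by
      rw [pow_two, Complex.mul_re]; ring
    rw [← hre, hxr, hw]
    nlinarith [sq_nonneg ((2 * (C : ℂ) * α + B).re)]
  have : (0 : ℤ) ≤ B ^ 2 - 4 * A * C := by exact_mod_cast this
  omega

/-- A non-real root with `C ≠ 0` forces a negative discriminant. [folklore] -/
theorem disc_neg_of_im_ne_zero {α : ℂ} {A B C : ℤ} (h : IsRel α A B C) (hC : C ≠ 0) (hα : α.im ≠ 0) :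
    B ^ 2 - 4 * A * C < 0 := by
  have hsq := sq_eq_disc h
  have him : (2 * (C : ℂ) * α + B).im ≠ 0 := by
    have e : (2 * (C : ℂ) * α + B).im = 2 * (C : ℝ) * α.im := by
      simp [Complex.mul_im]
    rw [e]
    exact mul_ne_zero (mul_ne_zero two_ne_zero (by exact_mod_cast hC)) hα
  have hlt := sq_neg_of_im_ne_zero (D := ((B ^ 2 - 4 * A * C : ℤ) : ℝ))
    (by rw [hsq, ← Complex.ofReal_intCast]) him
  exact_mod_cast hlt

/-- `C ≠ 0` for a non-trivial relation of a non-real number. [folklore] -/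
theorem C_ne_zero_of_im_ne_zero {α : ℂ} {A B C : ℤ} (h : IsRel α A B C) (h0 : (A, B, C) ≠ (0, 0, 0))
    (hα : α.im ≠ 0) : C ≠ 0 := by
  intro hC
  subst hC
  unfold IsRel at h
  simp only [Int.cast_zero, zero_mul, add_zero] at h
  have hB : B = 0 := by
    by_contra hB
    have := congrArg Complex.im h
    simp only [Complex.add_im, Complex.intCast_im, Complex.mul_im, Complex.intCast_re, zero_mul, add_zero,
      zero_add, Complex.zero_im, mul_eq_zero, Int.cast_eq_zero] at this
    exact this.elim hB hα
  subst hB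
  simp only [Int.cast_zero, zero_mul, add_zero, Int.cast_eq_zero] at h
  subst h
  exact h0 rfl

/-- The root `α = β/C` of `QData` satisfies the relation. [folklore] -/
theorem QData.isRel (Q : QData) : IsRel Q.α Q.A Q.B Q.C := by
  unfold IsRel QData.α
  have hC : (Q.C : ℂ) ≠ 0 := by exact_mod_cast Q.hC0
  field_simp
  linear_combination Q.hβ

/-- **A relation of minimal height.** [folklore] -/
theorem exists_min_rel {α : ℂ} (hex : ∃ A B C : ℤ, (A, B, C) ≠ (0, 0, 0) ∧ IsRel α A B C) :
    ∃ A B C : ℤ, (A, B, C) ≠ (0, 0, 0) ∧ IsRel α A B C ∧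
      ∀ A' B' C' : ℤ, (A', B', C') ≠ (0, 0, 0) → IsRel α A' B' C' → hgt (A, B, C) ≤ hgt (A', B', C') := by
  classical
  let P : ℕ → Prop := fun n => ∃ A B C : ℤ, (A, B, C) ≠ (0, 0, 0) ∧ IsRel α A B C ∧ (hgt (A, B, C)).toNat = n
  have hP : ∃ n, P n := by
    obtain ⟨A, B, C, h0, h⟩ := hex
    exact ⟨_, A, B, C, h0, h, rfl⟩
  obtain ⟨A, B, C, h0, h, hn⟩ := Nat.find_spec hP
  refine ⟨A, B, C, h0, h, fun A' B' C' h0' h' => ?_⟩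
  have hmin := Nat.find_min' hP ⟨A', B', C', h0', h', rfl⟩
  rw [← hn] at hmin
  have h1 := hgt_nonneg (A, B, C)
  have h2 := hgt_nonneg (A', B', C')
  omega

/-- **Theorem I for every complex root of every integer quadratic** (no longer of exact height),
with a constant: without complex multiplication there is `c ∈ (0, 1]` with
`c · exp(-(log H)^{7/2}) ≤ |τ - α|` for every `α = β/C` of `QData` with `B² - 4AC < 0`.
[cite: Masser1975, Theorem I (ε = ½, d = 2: "|τ - α| > C exp(-(log H)^{3+ε})")] -/
theorem thmI_root (S : TSetup) (hCM : ¬ S.L.HasCM) :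
    ∃ c : ℝ, 0 < c ∧ c ≤ 1 ∧ ∀ Q : QData, Q.B ^ 2 - 4 * Q.A * Q.C < 0 →
      c * Real.exp (-(Real.log Q.H) ^ (7 / 2 : ℝ)) ≤ ‖S.L.ω₂ / S.L.ω₁ - Q.α‖ := by
  classical
  obtain ⟨H₀, hH₀⟩ := masser_thmI_quadratic S (ε := 1 / 2) (by norm_num) (by norm_num)
  set τ := S.L.ω₂ / S.L.ω₁ with hτ
  -- the finitely many roots of small height
  set N : ℕ := ⌈H₀⌉₊ with hN
  set box : Finset (ℤ × ℤ × ℤ) := (Finset.Icc (-(N : ℤ)) N) ×ˢ ((Finset.Icc (-(N : ℤ)) N) ×ˢ (Finset.Icc (-(N : ℤ)) N))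
    with hbox
  set E : Set ℂ := {α | ∃ v ∈ box, v.2.2 ≠ 0 ∧ IsRel α v.1 v.2.1 v.2.2} with hE
  have hEfin : E.Finite := by
    have : E ⊆ ⋃ v ∈ (box : Set (ℤ × ℤ × ℤ)), {α | v.2.2 ≠ 0 ∧ IsRel α v.1 v.2.1 v.2.2} := by
      intro α hα
      obtain ⟨v, hv, h⟩ := hα
      exact Set.mem_biUnion hv h
    refine Set.Finite.subset (Set.Finite.biUnion box.finite_toSet fun v _ => ?_) this
    by_cases hC : v.2.2 = 0
    · simp [hC]
    · -- roots of a non-zero quadratic polynomial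
      have hsub : {α : ℂ | v.2.2 ≠ 0 ∧ IsRel α v.1 v.2.1 v.2.2} ⊆
          ((Polynomial.C (v.2.2 : ℂ) * Polynomial.X ^ 2 + Polynomial.C (v.2.1 : ℂ) * Polynomial.X +
            Polynomial.C (v.1 : ℂ)).roots.toFinset : Set ℂ) := by
        intro α hα
        obtain ⟨-, hrel⟩ := hα
        have hp : Polynomial.C (v.2.2 : ℂ) * Polynomial.X ^ 2 + Polynomial.C (v.2.1 : ℂ) * Polynomial.X +
            Polynomial.C (v.1 : ℂ) ≠ 0 := by
          have hdeg := Polynomial.degree_quadratic (b := (v.2.1 : ℂ)) (c := (v.1 : ℂ))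
            (show (v.2.2 : ℂ) ≠ 0 by exact_mod_cast hC)
          intro h0
          rw [h0, Polynomial.degree_zero] at hdeg
          cases hdeg
        simp only [Multiset.mem_toFinset, Finset.mem_coe]
        rw [Polynomial.mem_roots hp]
        unfold IsRel at hrel
        simp only [Polynomial.IsRoot, Polynomial.eval_add, Polynomial.eval_mul, Polynomial.eval_C,
          Polynomial.eval_pow, Polynomial.eval_X]
        linear_combination hrel
      exact Set.Finite.subset (Finset.finite_toSet _) hsub
  -- `τ ∉ E`, so a positive minimal distance
  have hτE : ∀ α ∈ E, 0 < ‖τ - α‖ := by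
    intro α hα
    rw [norm_pos_iff, sub_ne_zero]
    rintro rfl
    obtain ⟨v, -, hC, hrel⟩ := hα
    exact hCM (hasCM_of_quadratic S.L (A := v.1) (B := v.2.1) (C := v.2.2)
      (by intro h0; simp only [Prod.mk.injEq] at h0; exact hC h0.2.2) hrel)
  obtain ⟨m, hm0, hm⟩ : ∃ m : ℝ, 0 < m ∧ ∀ α ∈ E, m ≤ ‖τ - α‖ := by
    rcases E.eq_empty_or_nonempty with hE0 | hEne
    · exact ⟨1, one_pos, fun α hα => by simp [hE0] at hα⟩
    · obtain ⟨α₀, hα₀, hmin⟩ := Set.exists_min_image E (fun α => ‖τ - α‖) hEfin hEne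
      exact ⟨‖τ - α₀‖, hτE α₀ hα₀, hmin⟩
  refine ⟨min 1 m, lt_min one_pos hm0, min_le_left _ _, fun Q hdisc => ?_⟩
  -- the relation of minimal height of `α`
  set α := Q.α with hα
  have hαim : α.im ≠ 0 := im_ne_zero_of_disc_neg Q.isRel hdisc
  obtain ⟨A, B, C, h0, hrel, hmin⟩ := exists_min_rel ⟨Q.A, Q.B, Q.C, fun h => Q.hC0 (by
    simp only [Prod.mk.injEq] at h; exact h.2.2), Q.isRel⟩
  have hC : C ≠ 0 := C_ne_zero_of_im_ne_zero hrel h0 hαim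
  have hd : B ^ 2 - 4 * A * C < 0 := disc_neg_of_im_ne_zero hrel hC hαim
  set h₀ : ℤ := hgt (A, B, C) with hh₀
  have hh₀1 : 1 ≤ h₀ := one_le_hgt (v := (A, B, C)) (by
    intro h; apply h0; simp only [Prod.mk.injEq]; simp only [Prod.ext_iff, Prod.fst_zero, Prod.snd_zero] at h; exact h)
  obtain ⟨hA, hB, hCle⟩ := abs_le_hgt (A, B, C)
  have hexp_le_one : Real.exp (-(Real.log Q.H) ^ (7 / 2 : ℝ)) ≤ 1 := by
    rw [Real.exp_le_one_iff, neg_nonpos]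
    exact Real.rpow_nonneg (Real.log_nonneg (by exact_mod_cast Q.one_le_H)) _
  -- the exact-height data
  let Q₀ : QData :=
    { A := A, B := B, C := C, H := h₀.toNat
      one_le_H := by omega
      hA := by rw [Int.toNat_of_nonneg (by omega)]; exact hA
      hB := by rw [Int.toNat_of_nonneg (by omega)]; exact hB
      hC := by rw [Int.toNat_of_nonneg (by omega)]; exact hCle
      hC0 := hC
      β := C * α
      hβ := by
        unfold IsRel at hrel
        linear_combination (C : ℂ) * hrel }
  have hQ₀α : Q₀.α = α := by
    change (C : ℂ) * α / C = α
    field_simp [show (C : ℂ) ≠ 0 by exact_mod_cast hC]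
  have hH₀H : ((h₀.toNat : ℕ) : ℝ) ≤ Q.H := by
    have h1 : h₀ ≤ hgt (Q.A, Q.B, Q.C) := hmin Q.A Q.B Q.C (fun h => Q.hC0 (by
      simp only [Prod.mk.injEq] at h; exact h.2.2)) Q.isRel
    have h2 : hgt (Q.A, Q.B, Q.C) ≤ Q.H := max_le Q.hA (max_le Q.hB Q.hC)
    have : ((h₀.toNat : ℕ) : ℤ) ≤ Q.H := by rw [Int.toNat_of_nonneg (by omega)]; exact h1.trans h2
    exact_mod_cast this
  by_cases hlarge : H₀ ≤ ((h₀.toNat : ℕ) : ℝ)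
  · -- Theorem I at the exact height `h₀ ≤ H`
    have hmin₀ : ∀ A' B' C' : ℤ, (A', B', C') ≠ (0, 0, 0) →
        (A' : ℂ) + (B' : ℂ) * Q₀.α + (C' : ℂ) * Q₀.α ^ 2 = 0 → ((Q₀.H : ℕ) : ℤ) ≤ max |A'| (max |B'| |C'|) := by
      intro A' B' C' h0' hrel'
      rw [hQ₀α] at hrel'
      have := hmin A' B' C' h0' hrel'
      change ((h₀.toNat : ℕ) : ℤ) ≤ hgt (A', B', C')
      rw [Int.toNat_of_nonneg (by omega)]; exact this
    have hT := hH₀ Q₀ hlarge hd hmin₀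
    rw [hQ₀α] at hT
    have hmono : Real.exp (-(Real.log Q.H) ^ (7 / 2 : ℝ)) ≤ Real.exp (-(Real.log Q₀.H) ^ (3 + 1 / 2 : ℝ)) := by
      rw [show (3 + 1 / 2 : ℝ) = 7 / 2 by norm_num, Real.exp_le_exp, neg_le_neg_iff]
      have h1 : (1 : ℝ) ≤ Q₀.H := by exact_mod_cast Q₀.one_le_H
      exact Real.rpow_le_rpow (Real.log_nonneg h1) (Real.log_le_log (by linarith) hH₀H) (by norm_num)
    calc min 1 m * Real.exp (-(Real.log Q.H) ^ (7 / 2 : ℝ)) ≤ 1 * Real.exp (-(Real.log Q.H) ^ (7 / 2 : ℝ)) :=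
          mul_le_mul_of_nonneg_right (min_le_left _ _) (Real.exp_nonneg _)
      _ ≤ ‖τ - α‖ := by rw [one_mul]; exact hmono.trans hT
  · -- small height: `α ∈ E`
    push Not at hlarge
    have hαE : α ∈ E := by
      refine ⟨(A, B, C), ?_, hC, hrel⟩
      have hN' : h₀ ≤ N := by
        have : ((h₀.toNat : ℕ) : ℝ) ≤ N := hlarge.le.trans (Nat.le_ceil _)
        have : (h₀.toNat : ℤ) ≤ N := by exact_mod_cast this
        rwa [Int.toNat_of_nonneg (by omega)] at this
      simp only [hbox, Finset.mem_product, Finset.mem_Icc]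
      exact ⟨abs_le.mp (hA.trans hN'), abs_le.mp (hB.trans hN'), abs_le.mp (hCle.trans hN')⟩
    calc min 1 m * Real.exp (-(Real.log Q.H) ^ (7 / 2 : ℝ)) ≤ m * 1 :=
          mul_le_mul (min_le_right _ _) hexp_le_one (Real.exp_nonneg _) hm0.le
      _ ≤ ‖τ - α‖ := by rw [mul_one]; exact hm α hαE

end ThmICor

/-! ### A lower bound for `|Aω₁² + Bω₁ω₂ + Cω₂²|` -/

section QuadForm

/-- `Aω₁² + Bω₁ω₂ + Cω₂² = ω₁² (A + Bτ + Cτ²)`. [folklore] -/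
theorem periodForm_eq (L : PeriodPair) (v : ℤ × ℤ × ℤ) :
    periodForm L v = L.ω₁ ^ 2 * ((v.1 : ℂ) + (v.2.1 : ℂ) * (L.ω₂ / L.ω₁) + (v.2.2 : ℂ) * (L.ω₂ / L.ω₁) ^ 2) := by
  have hω₁ : L.ω₁ ≠ 0 := by simpa using basis_ne_zero L 0
  unfold periodForm; field_simp

/-- `|A + Bτ| ≥ c₈ max(|A|, |B|)` since `τ` is not real. [cite: Masser1975, Lemma 2.2 (proof of (iii))] -/
theorem norm_linear_ge (L : PeriodPair) : ∃ c : ℝ, 0 < c ∧ ∀ A B : ℤ,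
    c * max |(A : ℝ)| |(B : ℝ)| ≤ ‖(A : ℂ) + (B : ℂ) * (L.ω₂ / L.ω₁)‖ := by
  set τ := L.ω₂ / L.ω₁ with hτ
  have hm : τ.im ≠ 0 := im_tau_ne_zero L
  set u := |τ.re| with hu
  set m := |τ.im| with hm'
  have hm0 : 0 < m := abs_pos.mpr hm
  have hu0 : 0 ≤ u := abs_nonneg _
  refine ⟨min (1 / 2) (m / (2 * (u + 1))), lt_min (by norm_num) (by positivity), fun A B => ?_⟩
  have hre : ((A : ℂ) + (B : ℂ) * τ).re = A + B * τ.re := by simp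
  have him : ((A : ℂ) + (B : ℂ) * τ).im = B * τ.im := by simp
  have h1 : |(A : ℝ) + B * τ.re| ≤ ‖(A : ℂ) + (B : ℂ) * τ‖ := by rw [← hre]; exact Complex.abs_re_le_norm _
  have h2 : |(B : ℝ)| * m ≤ ‖(A : ℂ) + (B : ℂ) * τ‖ := by
    rw [hm', ← abs_mul, ← him]; exact Complex.abs_im_le_norm _
  rcases le_or_gt (2 * |(B : ℝ)| * (u + 1)) |(A : ℝ)| with hcase | hcase
  · -- `|A| ≥ 2|B|(|u|+1)`: the real part dominates
    have hmax : max |(A : ℝ)| |(B : ℝ)| = |(A : ℝ)| := by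
      refine max_eq_left ?_
      nlinarith [abs_nonneg (B : ℝ)]
    rw [hmax]
    have h3 : |(A : ℝ)| / 2 ≤ |(A : ℝ) + B * τ.re| := by
      have h4 : |(B : ℝ) * τ.re| ≤ |(A : ℝ)| / 2 := by
        rw [abs_mul]; nlinarith [abs_nonneg (B : ℝ), abs_nonneg τ.re]
      have := abs_sub_abs_le_abs_sub (A : ℝ) (-(B * τ.re))
      rw [abs_neg, sub_neg_eq_add] at this
      linarith
    calc min (1 / 2) (m / (2 * (u + 1))) * |(A : ℝ)| ≤ 1 / 2 * |(A : ℝ)| :=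
          mul_le_mul_of_nonneg_right (min_le_left _ _) (abs_nonneg _)
      _ ≤ _ := by linarith
  · -- `|A| < 2|B|(|u|+1)`: the imaginary part dominates
    have hmax : max |(A : ℝ)| |(B : ℝ)| ≤ 2 * |(B : ℝ)| * (u + 1) :=
      max_le hcase.le (by nlinarith [abs_nonneg (B : ℝ)])
    calc min (1 / 2) (m / (2 * (u + 1))) * max |(A : ℝ)| |(B : ℝ)|
        ≤ m / (2 * (u + 1)) * (2 * |(B : ℝ)| * (u + 1)) :=
          mul_le_mul (min_le_right _ _) hmax (by positivity) (by positivity)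
      _ = |(B : ℝ)| * m := by field_simp
      _ ≤ _ := h2

/-- **Lower bound for the quadratic form** (Theorem I for both roots, or trivial bounds):
without complex multiplication there is `c > 0` with
`c · exp(-2 (log H)^{7/2}) ≤ |Aω₁² + Bω₁ω₂ + Cω₂²|` for every `(A, B, C) ≠ 0` of height `H`.
[cite: Masser1975, Lemma 2.2 (proof: "δ = Cω₁²(τ-α)(τ-α')" and Theorem I with ε = ½)] -/
theorem quadForm_lower (S : TSetup) (hCM : ¬ S.L.HasCM) :
    ∃ c : ℝ, 0 < c ∧ ∀ v : ℤ × ℤ × ℤ, v ≠ 0 →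
      c * Real.exp (-2 * (Real.log (hgt v)) ^ (7 / 2 : ℝ)) ≤ ‖periodForm S.L v‖ := by
  obtain ⟨c₁, hc₁0, hc₁1, hT⟩ := thmI_root S hCM
  set τ := S.L.ω₂ / S.L.ω₁ with hτ
  have hω₁ : S.L.ω₁ ≠ 0 := by simpa using basis_ne_zero S.L 0
  have hω₁0 : 0 < ‖S.L.ω₁‖ := norm_pos_iff.mpr hω₁
  set r := |τ.im| with hr
  have hr0 : 0 < r := abs_pos.mpr (im_tau_ne_zero S.L)
  set κ : ℝ := min (c₁ ^ 2) (min (r ^ 2) (min r 1)) with hκ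
  have hκ0 : 0 < κ := lt_min (by positivity) (lt_min (by positivity) (lt_min hr0 one_pos))
  refine ⟨‖S.L.ω₁‖ ^ 2 * κ, by positivity, fun v hv => ?_⟩
  obtain ⟨A, B, C⟩ := v
  set H : ℤ := hgt (A, B, C) with hH
  have hH1 : 1 ≤ H := one_le_hgt hv
  obtain ⟨hA, hB, hCle⟩ := abs_le_hgt (A, B, C)
  have hlog0 : 0 ≤ Real.log (H : ℝ) := Real.log_nonneg (by exact_mod_cast hH1)
  set e := Real.exp (-2 * (Real.log (H : ℝ)) ^ (7 / 2 : ℝ)) with he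
  have he1 : e ≤ 1 := by
    rw [he, Real.exp_le_one_iff]
    have := Real.rpow_nonneg hlog0 (7 / 2 : ℝ)
    linarith
  have he0 : 0 < e := Real.exp_pos _
  set q : ℂ := (A : ℂ) + (B : ℂ) * τ + (C : ℂ) * τ ^ 2 with hq
  have hpf : periodForm S.L (A, B, C) = S.L.ω₁ ^ 2 * q := periodForm_eq S.L (A, B, C)
  -- it suffices to bound `q`
  suffices hmain : κ * e ≤ ‖q‖ by
    rw [hpf, norm_mul, norm_pow]
    calc ‖S.L.ω₁‖ ^ 2 * κ * e = ‖S.L.ω₁‖ ^ 2 * (κ * e) := by ring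
      _ ≤ ‖S.L.ω₁‖ ^ 2 * ‖q‖ := mul_le_mul_of_nonneg_left hmain (by positivity)
  have hκe : κ * e ≤ κ := mul_le_of_le_one_right hκ0.le he1
  have hκ1 : κ ≤ 1 := (min_le_right _ _).trans ((min_le_right _ _).trans (min_le_right _ _))
  have hκr : κ ≤ r := (min_le_right _ _).trans ((min_le_right _ _).trans (min_le_left _ _))
  have hκr2 : κ ≤ r ^ 2 := (min_le_right _ _).trans (min_le_left _ _)
  have hκc : κ ≤ c₁ ^ 2 := min_le_left _ _
  by_cases hC : C = 0
  · subst hC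
    simp only [Int.cast_zero, zero_mul, add_zero] at hq
    by_cases hB0 : B = 0
    · subst hB0
      have hA0 : A ≠ 0 := by rintro rfl; exact hv rfl
      have : (1 : ℝ) ≤ ‖q‖ := by
        rw [hq]; simp only [Int.cast_zero, zero_mul, add_zero, Complex.norm_intCast]
        exact_mod_cast Int.one_le_abs hA0
      linarith
    · have : r ≤ ‖q‖ := by
        have him : q.im = B * τ.im := by rw [hq]; simp
        have h1 : |q.im| ≤ ‖q‖ := Complex.abs_im_le_norm q
        rw [him, abs_mul] at h1
        have hB1 : (1 : ℝ) ≤ |(B : ℝ)| := by exact_mod_cast Int.one_le_abs hB0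
        nlinarith
      linarith
  · -- `C ≠ 0`: factor over the roots
    obtain ⟨sD, hsD⟩ := IsAlgClosed.exists_eq_mul_self (((B ^ 2 - 4 * A * C : ℤ) : ℂ))
    set β : ℂ := (sD - B) / 2 with hβ
    set β' : ℂ := (-sD - B) / 2 with hβ'
    have hsD2 : sD ^ 2 = ((B ^ 2 - 4 * A * C : ℤ) : ℂ) := by rw [hsD]; ring
    have hβrel : β ^ 2 + B * β + A * C = 0 := by
      rw [hβ]; push_cast at hsD2; linear_combination (1 / 4 : ℂ) * hsD2
    have hβ'rel : β' ^ 2 + B * β' + A * C = 0 := by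
      rw [hβ']; push_cast at hsD2; linear_combination (1 / 4 : ℂ) * hsD2
    have hCc : (C : ℂ) ≠ 0 := by exact_mod_cast hC
    have hfac : q = (C : ℂ) * (τ - β / C) * (τ - β' / C) := by
      rw [hq]; field_simp; rw [hβ, hβ']; push_cast at hsD2; linear_combination (1 / 4 : ℂ) * hsD2
    have hnq : ‖τ - β / C‖ * ‖τ - β' / C‖ ≤ ‖q‖ := by
      rw [hfac, norm_mul, norm_mul, Complex.norm_intCast]
      have hC1 : (1 : ℝ) ≤ |(C : ℝ)| := by exact_mod_cast Int.one_le_abs hC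
      have := mul_le_mul_of_nonneg_right hC1 (by positivity : 0 ≤ ‖τ - β / C‖ * ‖τ - β' / C‖)
      linarith
    -- the `QData` of the two roots
    have hHnat : ((H.toNat : ℕ) : ℤ) = H := Int.toNat_of_nonneg (by omega)
    let Q : QData :=
      { A := A, B := B, C := C, H := H.toNat, one_le_H := by omega
        hA := by rw [Int.toNat_of_nonneg (by omega)]; exact hA
        hB := by rw [Int.toNat_of_nonneg (by omega)]; exact hB
        hC := by rw [Int.toNat_of_nonneg (by omega)]; exact hCle
        hC0 := hC, β := β, hβ := hβrel }
    let Q' : QData :=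
      { A := A, B := B, C := C, H := H.toNat, one_le_H := by omega
        hA := by rw [Int.toNat_of_nonneg (by omega)]; exact hA
        hB := by rw [Int.toNat_of_nonneg (by omega)]; exact hB
        hC := by rw [Int.toNat_of_nonneg (by omega)]; exact hCle
        hC0 := hC, β := β', hβ := hβ'rel }
    have hQH : ((Q.H : ℕ) : ℝ) = (H : ℝ) := by
      change ((H.toNat : ℕ) : ℝ) = (H : ℝ); exact_mod_cast hHnat
    by_cases hdisc : B ^ 2 - 4 * A * C < 0
    · -- Theorem I for both roots
      have h1 := hT Q hdisc
      have h2 := hT Q' hdisc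
      change c₁ * Real.exp (-(Real.log ((H.toNat : ℕ) : ℝ)) ^ (7 / 2 : ℝ)) ≤ ‖τ - β / C‖ at h1
      change c₁ * Real.exp (-(Real.log ((H.toNat : ℕ) : ℝ)) ^ (7 / 2 : ℝ)) ≤ ‖τ - β' / C‖ at h2
      have hHc : ((H.toNat : ℕ) : ℝ) = (H : ℝ) := by exact_mod_cast hHnat
      rw [hHc] at h1 h2
      have he2 : Real.exp (-(Real.log (H : ℝ)) ^ (7 / 2 : ℝ)) * Real.exp (-(Real.log (H : ℝ)) ^ (7 / 2 : ℝ)) = e := by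
        rw [he, ← Real.exp_add]; ring_nf
      have hprod := mul_le_mul h1 h2 (by positivity) (norm_nonneg _)
      calc κ * e ≤ c₁ ^ 2 * e := mul_le_mul_of_nonneg_right hκc he0.le
        _ = c₁ * Real.exp (-(Real.log (H : ℝ)) ^ (7 / 2 : ℝ)) * (c₁ * Real.exp (-(Real.log (H : ℝ)) ^ (7 / 2 : ℝ))) := by
            rw [← he2]; ring
        _ ≤ ‖τ - β / C‖ * ‖τ - β' / C‖ := hprod
        _ ≤ ‖q‖ := hnq
    · -- real roots: `|τ - α| ≥ |Im τ|`
      push Not at hdisc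
      have hsDim : sD.im = 0 := im_eq_zero_of_sq_nonneg (D := ((B ^ 2 - 4 * A * C : ℤ) : ℝ))
        (by rw [hsD2, ← Complex.ofReal_intCast]) (by exact_mod_cast hdisc)
      have hroot : ∀ γ : ℂ, γ.im = 0 → r ≤ ‖τ - γ / C‖ := by
        intro γ hγ
        have : (τ - γ / C).im = τ.im := by
          rw [Complex.sub_im, ← Complex.ofReal_intCast, Complex.div_ofReal_im, hγ, zero_div, sub_zero]
        calc r = |(τ - γ / C).im| := by rw [this]
          _ ≤ ‖τ - γ / C‖ := Complex.abs_im_le_norm _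
      have h1 := hroot β (by rw [hβ]; simp [hsDim])
      have h2 := hroot β' (by rw [hβ']; simp [hsDim])
      calc κ * e ≤ r ^ 2 * 1 := mul_le_mul hκr2 he1 he0.le (by positivity)
        _ = r * r := by ring
        _ ≤ ‖τ - β / C‖ * ‖τ - β' / C‖ := mul_le_mul h1 h2 hr0.le (norm_nonneg _)
        _ ≤ ‖q‖ := hnq

end QuadForm

/-! ### Lemma 2.2 -/

section Lemma22

/-- **Non-complex triples give a form bounded below**: if `C = 0` or `B² - 4AC ≥ 0` then
`|Aω₁² + Bω₁ω₂ + Cω₂²| ≥ |ω₁|² min(|Im τ|², |Im τ|, 1)`. [cite: Masser1975, Lemma 2.2 (proof)] -/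
theorem periodForm_ge_of_not_complex (L : PeriodPair) {v : ℤ × ℤ × ℤ} (hv : v ≠ 0)
    (h : v.2.2 = 0 ∨ 0 ≤ v.2.1 ^ 2 - 4 * v.1 * v.2.2) :
    ‖L.ω₁‖ ^ 2 * min (|(L.ω₂ / L.ω₁).im| ^ 2) (min |(L.ω₂ / L.ω₁).im| 1) ≤ ‖periodForm L v‖ := by
  set τ := L.ω₂ / L.ω₁ with hτ
  set r := |τ.im| with hr
  have hr0 : 0 < r := abs_pos.mpr (im_tau_ne_zero L)
  obtain ⟨A, B, C⟩ := v
  set q : ℂ := (A : ℂ) + (B : ℂ) * τ + (C : ℂ) * τ ^ 2 with hq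
  have hpf : periodForm L (A, B, C) = L.ω₁ ^ 2 * q := periodForm_eq L (A, B, C)
  suffices hmain : min (r ^ 2) (min r 1) ≤ ‖q‖ by
    rw [hpf, norm_mul, norm_pow]
    exact mul_le_mul_of_nonneg_left hmain (by positivity)
  have m1 : min (r ^ 2) (min r 1) ≤ 1 := (min_le_right _ _).trans (min_le_right _ _)
  have mr : min (r ^ 2) (min r 1) ≤ r := (min_le_right _ _).trans (min_le_left _ _)
  have mr2 : min (r ^ 2) (min r 1) ≤ r ^ 2 := min_le_left _ _
  simp only at h
  by_cases hC : C = 0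
  · subst hC
    simp only [Int.cast_zero, zero_mul, add_zero] at hq
    by_cases hB0 : B = 0
    · subst hB0
      have hA0 : A ≠ 0 := by rintro rfl; exact hv rfl
      have : (1 : ℝ) ≤ ‖q‖ := by
        rw [hq]; simp only [Int.cast_zero, zero_mul, add_zero, Complex.norm_intCast]
        exact_mod_cast Int.one_le_abs hA0
      linarith
    · have him : q.im = B * τ.im := by rw [hq]; simp
      have h1 : |q.im| ≤ ‖q‖ := Complex.abs_im_le_norm q
      rw [him, abs_mul] at h1
      have hB1 : (1 : ℝ) ≤ |(B : ℝ)| := by exact_mod_cast Int.one_le_abs hB0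
      nlinarith
  · have hdisc : 0 ≤ B ^ 2 - 4 * A * C := h.resolve_left hC
    obtain ⟨sD, hsD⟩ := IsAlgClosed.exists_eq_mul_self (((B ^ 2 - 4 * A * C : ℤ) : ℂ))
    have hsD2 : sD ^ 2 = ((B ^ 2 - 4 * A * C : ℤ) : ℂ) := by rw [hsD]; ring
    have hCc : (C : ℂ) ≠ 0 := by exact_mod_cast hC
    have hfac : q = (C : ℂ) * (τ - (sD - B) / 2 / C) * (τ - (-sD - B) / 2 / C) := by
      rw [hq]; field_simp; push_cast at hsD2; linear_combination hsD2
    have hnq : ‖τ - (sD - B) / 2 / C‖ * ‖τ - (-sD - B) / 2 / C‖ ≤ ‖q‖ := by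
      rw [hfac, norm_mul, norm_mul, Complex.norm_intCast]
      have hC1 : (1 : ℝ) ≤ |(C : ℝ)| := by exact_mod_cast Int.one_le_abs hC
      have := mul_le_mul_of_nonneg_right hC1
        (by positivity : 0 ≤ ‖τ - (sD - B) / 2 / C‖ * ‖τ - (-sD - B) / 2 / C‖)
      linarith
    have hsDim : sD.im = 0 := im_eq_zero_of_sq_nonneg (D := ((B ^ 2 - 4 * A * C : ℤ) : ℝ))
      (by rw [hsD2, ← Complex.ofReal_intCast]) (by exact_mod_cast hdisc)
    have hroot : ∀ γ : ℂ, γ.im = 0 → r ≤ ‖τ - γ / C‖ := by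
      intro γ hγ
      have : (τ - γ / C).im = τ.im := by
        rw [Complex.sub_im, ← Complex.ofReal_intCast, Complex.div_ofReal_im, hγ, zero_div, sub_zero]
      calc r = |(τ - γ / C).im| := by rw [this]
        _ ≤ ‖τ - γ / C‖ := Complex.abs_im_le_norm _
    have h1 := hroot ((sD - B) / 2) (by simp [hsDim])
    have h2 := hroot ((-sD - B) / 2) (by simp [hsDim])
    calc min (r ^ 2) (min r 1) ≤ r * r := by rw [← pow_two]; exact mr2
      _ ≤ _ := mul_le_mul h1 h2 hr0.le (norm_nonneg _)
      _ ≤ ‖q‖ := hnq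

/-- **A root close to `τ`**: for `C ≠ 0`, `B² - 4AC < 0` there is a root `α` of `A + Bx + Cx²`
(as `QData` of height `H = max(|A|,|B|,|C|)`) with `|ω₁|² |τ - α|² ≤ |Aω₁² + Bω₁ω₂ + Cω₂²|`.
[cite: Masser1975, Lemma 2.2 (proof: "we may assume without loss of generality that |τ - α| < c₇X^{-½}")] -/
theorem exists_close_root (L : PeriodPair) {v : ℤ × ℤ × ℤ} (hC : v.2.2 ≠ 0)
    (hdisc : v.2.1 ^ 2 - 4 * v.1 * v.2.2 < 0) :
    ∃ Q : QData, Q.A = v.1 ∧ Q.B = v.2.1 ∧ Q.C = v.2.2 ∧ ((Q.H : ℕ) : ℤ) = hgt v ∧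
      ‖L.ω₁‖ ^ 2 * ‖L.ω₂ / L.ω₁ - Q.α‖ ^ 2 ≤ ‖periodForm L v‖ := by
  set τ := L.ω₂ / L.ω₁ with hτ
  obtain ⟨A, B, C⟩ := v
  simp only at hC hdisc
  set H : ℤ := hgt (A, B, C) with hH
  have hv : (A, B, C) ≠ (0 : ℤ × ℤ × ℤ) := by intro h; apply hC; simpa using congrArg (fun w => w.2.2) h
  have hH1 : 1 ≤ H := one_le_hgt hv
  obtain ⟨hA, hB, hCle⟩ := abs_le_hgt (A, B, C)
  set q : ℂ := (A : ℂ) + (B : ℂ) * τ + (C : ℂ) * τ ^ 2 with hq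
  have hpf : periodForm L (A, B, C) = L.ω₁ ^ 2 * q := periodForm_eq L (A, B, C)
  obtain ⟨sD, hsD⟩ := IsAlgClosed.exists_eq_mul_self (((B ^ 2 - 4 * A * C : ℤ) : ℂ))
  set β : ℂ := (sD - B) / 2 with hβ
  set β' : ℂ := (-sD - B) / 2 with hβ'
  have hsD2 : sD ^ 2 = ((B ^ 2 - 4 * A * C : ℤ) : ℂ) := by rw [hsD]; ring
  have hβrel : β ^ 2 + B * β + A * C = 0 := by
    rw [hβ]; push_cast at hsD2; linear_combination (1 / 4 : ℂ) * hsD2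
  have hβ'rel : β' ^ 2 + B * β' + A * C = 0 := by
    rw [hβ']; push_cast at hsD2; linear_combination (1 / 4 : ℂ) * hsD2
  have hCc : (C : ℂ) ≠ 0 := by exact_mod_cast hC
  have hfac : q = (C : ℂ) * (τ - β / C) * (τ - β' / C) := by
    rw [hq]; field_simp; rw [hβ, hβ']; push_cast at hsD2; linear_combination (1 / 4 : ℂ) * hsD2
  have hnq : ‖τ - β / C‖ * ‖τ - β' / C‖ ≤ ‖q‖ := by
    rw [hfac, norm_mul, norm_mul, Complex.norm_intCast]
    have hC1 : (1 : ℝ) ≤ |(C : ℝ)| := by exact_mod_cast Int.one_le_abs hC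
    have := mul_le_mul_of_nonneg_right hC1 (by positivity : 0 ≤ ‖τ - β / C‖ * ‖τ - β' / C‖)
    linarith
  let mk : ∀ γ : ℂ, γ ^ 2 + B * γ + A * C = 0 → QData := fun γ hγ =>
    { A := A, B := B, C := C, H := H.toNat, one_le_H := by omega
      hA := by rw [Int.toNat_of_nonneg (by omega)]; exact hA
      hB := by rw [Int.toNat_of_nonneg (by omega)]; exact hB
      hC := by rw [Int.toNat_of_nonneg (by omega)]; exact hCle
      hC0 := hC, β := γ, hβ := hγ }
  have hHnat : ((H.toNat : ℕ) : ℤ) = H := Int.toNat_of_nonneg (by omega)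
  -- the closer root
  rcases le_total ‖τ - β / C‖ ‖τ - β' / C‖ with hle | hle
  · refine ⟨mk β hβrel, rfl, rfl, rfl, hHnat, ?_⟩
    change ‖L.ω₁‖ ^ 2 * ‖τ - β / C‖ ^ 2 ≤ ‖periodForm L (A, B, C)‖
    rw [hpf, norm_mul, norm_pow]
    refine mul_le_mul_of_nonneg_left ?_ (by positivity)
    calc ‖τ - β / C‖ ^ 2 = ‖τ - β / C‖ * ‖τ - β / C‖ := pow_two _
      _ ≤ ‖τ - β / C‖ * ‖τ - β' / C‖ := mul_le_mul_of_nonneg_left hle (norm_nonneg _)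
      _ ≤ ‖q‖ := hnq
  · refine ⟨mk β' hβ'rel, rfl, rfl, rfl, hHnat, ?_⟩
    change ‖L.ω₁‖ ^ 2 * ‖τ - β' / C‖ ^ 2 ≤ ‖periodForm L (A, B, C)‖
    rw [hpf, norm_mul, norm_pow]
    refine mul_le_mul_of_nonneg_left ?_ (by positivity)
    calc ‖τ - β' / C‖ ^ 2 = ‖τ - β' / C‖ * ‖τ - β' / C‖ := pow_two _
      _ ≤ ‖τ - β / C‖ * ‖τ - β' / C‖ := mul_le_mul_of_nonneg_right hle (norm_nonneg _)
      _ ≤ ‖q‖ := hnq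

/-- **(iii) of Lemma 2.2**: if `|Aω₁² + Bω₁ω₂ + Cω₂²| < 1` and `C ≠ 0` then `|C| > c₃ H`
("since `τ` is not real we have `|Aω₁² + Bω₁ω₂| ≥ c₈ max(|A|, |B|)`"). [cite: Masser1975, Lemma 2.2 (iii)] -/
theorem hgt_lt_of_small (L : PeriodPair) : ∃ c₃ : ℝ, 0 < c₃ ∧ ∀ v : ℤ × ℤ × ℤ, v.2.2 ≠ 0 →
    ‖periodForm L v‖ < 1 → c₃ * hgt v < |(v.2.2 : ℝ)| := by
  obtain ⟨c₈, hc₈0, h8⟩ := norm_linear_ge L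
  have hω₁ : L.ω₁ ≠ 0 := by simpa using basis_ne_zero L 0
  have hω₁0 : 0 < ‖L.ω₁‖ := norm_pos_iff.mpr hω₁
  set d₈ : ℝ := ‖L.ω₁‖ ^ 2 * c₈ with hd₈
  have hd₈0 : 0 < d₈ := by positivity
  set M : ℝ := (1 + ‖L.ω₂‖ ^ 2) / d₈ + 1 with hM
  have hM0 : 0 < M := by positivity
  refine ⟨M⁻¹, by positivity, fun v hC hsmall => ?_⟩
  obtain ⟨A, B, C⟩ := v
  simp only at hC ⊢
  have h8AB := h8 A B
  have hsplit : periodForm L (A, B, C) =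
      L.ω₁ ^ 2 * ((A : ℂ) + (B : ℂ) * (L.ω₂ / L.ω₁)) + (C : ℂ) * L.ω₂ ^ 2 := by
    unfold periodForm; field_simp
  have h1 : ‖L.ω₁ ^ 2 * ((A : ℂ) + (B : ℂ) * (L.ω₂ / L.ω₁))‖ ≤
      ‖periodForm L (A, B, C)‖ + ‖(C : ℂ) * L.ω₂ ^ 2‖ := by
    rw [hsplit]; exact norm_le_add_norm_add _ _
  rw [norm_mul, norm_pow, norm_mul, norm_pow, Complex.norm_intCast] at h1
  have hlin : d₈ * max |(A : ℝ)| |(B : ℝ)| < 1 + |(C : ℝ)| * ‖L.ω₂‖ ^ 2 := by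
    have h2 : ‖L.ω₁‖ ^ 2 * (c₈ * max |(A : ℝ)| |(B : ℝ)|) ≤
        ‖L.ω₁‖ ^ 2 * ‖(A : ℂ) + (B : ℂ) * (L.ω₂ / L.ω₁)‖ := mul_le_mul_of_nonneg_left h8AB (by positivity)
    have h3 : d₈ * max |(A : ℝ)| |(B : ℝ)| = ‖L.ω₁‖ ^ 2 * (c₈ * max |(A : ℝ)| |(B : ℝ)|) := by rw [hd₈]; ring
    linarith
  have hC1 : (1 : ℝ) ≤ |(C : ℝ)| := by exact_mod_cast Int.one_le_abs hC
  have hhgt : (hgt (A, B, C) : ℝ) ≤ max |(A : ℝ)| |(B : ℝ)| + |(C : ℝ)| := by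
    unfold hgt; push_cast
    have hA0 := abs_nonneg (A : ℝ)
    have hC0 := abs_nonneg (C : ℝ)
    have hmA := le_max_left |(A : ℝ)| |(B : ℝ)|
    have hmB := le_max_right |(A : ℝ)| |(B : ℝ)|
    exact max_le (by linarith) (max_le (by linarith) (by linarith))
  -- `H ≤ max(|A|,|B|) + |C| < (1 + |C||ω₂|²)/d₈ + |C| ≤ |C| (1 + |ω₂|²)/d₈ + |C| = |C| M`
  have hkey : (hgt (A, B, C) : ℝ) < |(C : ℝ)| * M := by
    have e1 : max |(A : ℝ)| |(B : ℝ)| < (1 + |(C : ℝ)| * ‖L.ω₂‖ ^ 2) / d₈ := by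
      rw [lt_div_iff₀ hd₈0]; linarith
    have e2 : (1 + |(C : ℝ)| * ‖L.ω₂‖ ^ 2) / d₈ ≤ |(C : ℝ)| * (1 + ‖L.ω₂‖ ^ 2) / d₈ :=
      div_le_div_of_nonneg_right (by nlinarith [norm_nonneg L.ω₂]) hd₈0.le
    have e3 : |(C : ℝ)| * M = |(C : ℝ)| * (1 + ‖L.ω₂‖ ^ 2) / d₈ + |(C : ℝ)| := by rw [hM]; ring
    linarith
  calc M⁻¹ * (hgt (A, B, C) : ℝ) < M⁻¹ * (|(C : ℝ)| * M) := mul_lt_mul_of_pos_left hkey (by positivity)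
    _ = |(C : ℝ)| := by field_simp

/-- rpow bookkeeping: `ℓ^{7/8} ≤ ℓ/4` for `ℓ ≥ 4⁸`. [folklore] -/
theorem rpow_seven_eighths_le {ℓ : ℝ} (h : (4 : ℝ) ^ 8 ≤ ℓ) : ℓ ^ (7 / 8 : ℝ) ≤ ℓ / 4 := by
  have hℓ0 : 0 < ℓ := lt_of_lt_of_le (by norm_num) h
  have h4 : (4 : ℝ) ≤ ℓ ^ (1 / 8 : ℝ) := by
    have := Real.rpow_le_rpow (by norm_num) h (by norm_num : (0 : ℝ) ≤ 1 / 8)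
    rwa [show (1 / 8 : ℝ) = ((8 : ℕ) : ℝ)⁻¹ by norm_num, Real.pow_rpow_inv_natCast (by norm_num) (by norm_num),
      show (((8 : ℕ) : ℝ)⁻¹) = (1 / 8 : ℝ) by norm_num] at this
  have hsplit : ℓ = ℓ ^ (7 / 8 : ℝ) * ℓ ^ (1 / 8 : ℝ) := by
    rw [← Real.rpow_add hℓ0]; norm_num
  have h78 : 0 ≤ ℓ ^ (7 / 8 : ℝ) := by positivity
  nlinarith

/-- rpow bookkeeping: `324 ℓ^{7/2} ≤ ℓ⁴` for `ℓ ≥ 324²`. [folklore] -/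
theorem rpow_seven_halves_le {ℓ : ℝ} (h : (324 : ℝ) ^ 2 ≤ ℓ) : 324 * ℓ ^ (7 / 2 : ℝ) ≤ ℓ ^ 4 := by
  have hℓ0 : 0 < ℓ := lt_of_lt_of_le (by norm_num) h
  have h2 : (324 : ℝ) ≤ ℓ ^ (1 / 2 : ℝ) := by
    have := Real.rpow_le_rpow (by norm_num) h (by norm_num : (0 : ℝ) ≤ 1 / 2)
    rwa [show (1 / 2 : ℝ) = ((2 : ℕ) : ℝ)⁻¹ by norm_num, Real.pow_rpow_inv_natCast (by norm_num) (by norm_num),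
      show (((2 : ℕ) : ℝ)⁻¹) = (1 / 2 : ℝ) by norm_num] at this
  have hsplit : ℓ ^ 4 = ℓ ^ (7 / 2 : ℝ) * ℓ ^ (1 / 2 : ℝ) := by
    rw [← Real.rpow_add hℓ0, show (7 / 2 + 1 / 2 : ℝ) = ((4 : ℕ) : ℝ) by norm_num, Real.rpow_natCast]
  have h72 : 0 ≤ ℓ ^ (7 / 2 : ℝ) := by positivity
  nlinarith

/-- rpow bookkeeping: `(3ℓ)^{7/2} ≤ 81 ℓ^{7/2}`. [folklore] -/
theorem rpow_three_mul_le {ℓ : ℝ} (hℓ : 0 ≤ ℓ) : (3 * ℓ) ^ (7 / 2 : ℝ) ≤ 81 * ℓ ^ (7 / 2 : ℝ) := by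
  rw [Real.mul_rpow (by norm_num) hℓ]
  refine mul_le_mul_of_nonneg_right ?_ (by positivity)
  calc (3 : ℝ) ^ (7 / 2 : ℝ) ≤ 3 ^ (4 : ℝ) := Real.rpow_le_rpow_of_exponent_le (by norm_num) (by norm_num)
    _ = 81 := by rw [show (4 : ℝ) = ((4 : ℕ) : ℝ) by norm_num, Real.rpow_natCast]; norm_num

/-- **Lemma 2.2** (Masser 1975). For a lattice with algebraic invariants and without complex
multiplication there are `c₂, c₃ > 0` and `X₀` such that for every `X ≥ X₀` there are integers
`(A, B, C) ≠ 0` of height `H = max(|A|, |B|, |C|)` with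
(i) `e^{-(log X)⁴} < |Aω₁² + Bω₁ω₂ + Cω₂²| < X⁻¹`, (ii) `e^{(log X)^{1/4}} < H < c₂X²`,
(iii) `|C| > c₃H`. [cite: Masser1975, Lemma 2.2] -/
theorem masser_lemma_2_2 (S : TSetup) (hCM : ¬ S.L.HasCM) :
    ∃ c₂ c₃ X₀ : ℝ, 0 < c₂ ∧ 0 < c₃ ∧ ∀ X : ℝ, X₀ ≤ X →
      ∃ v : ℤ × ℤ × ℤ, v ≠ 0 ∧
        Real.exp (-(Real.log X) ^ 4) < ‖periodForm S.L v‖ ∧ ‖periodForm S.L v‖ < X⁻¹ ∧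
        Real.exp ((Real.log X) ^ (1 / 4 : ℝ)) < hgt v ∧ (hgt v : ℝ) < c₂ * X ^ 2 ∧
        c₃ * hgt v < |(v.2.2 : ℝ)| := by
  set L := S.L with hL
  set τ := L.ω₂ / L.ω₁ with hτ
  set W := Wc L with hW
  have hW0 : 0 ≤ W := Wc_nonneg L
  have hω₁ : L.ω₁ ≠ 0 := by simpa using basis_ne_zero L 0
  have hω₁0 : 0 < ‖L.ω₁‖ := norm_pos_iff.mpr hω₁
  set r := |τ.im| with hr
  have hr0 : 0 < r := abs_pos.mpr (im_tau_ne_zero L)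
  obtain ⟨c₁, hc₁0, -, hT⟩ := thmI_root S hCM
  obtain ⟨cq, hcq0, hq⟩ := quadForm_lower S hCM
  -- constants
  set K₀ : ℝ := ‖L.ω₁‖ ^ 2 * min (r ^ 2) (min r 1) with hK₀
  have hK₀0 : 0 < K₀ := by positivity
  set c₂ : ℝ := (4 * W + 3) ^ 2 + 2 with hc₂
  have hc₂1 : 1 ≤ c₂ := by rw [hc₂]; nlinarith
  obtain ⟨c₃, hc₃0, h3⟩ := hgt_lt_of_small L
  set κ₁ : ℝ := 2 * |Real.log (c₁ ^ 2 * ‖L.ω₁‖ ^ 2)| with hκ₁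
  set ℓ₀ : ℝ := max ((4 : ℝ) ^ 8) (max ((324 : ℝ) ^ 2) (max (κ₁ + 1) (max (2 * |Real.log cq| + 1) (Real.log c₂ + 1))))
    with hℓ₀
  set X₀ : ℝ := max 2 (max (2 / K₀) (Real.exp ℓ₀)) with hX₀
  refine ⟨c₂, c₃, X₀, by positivity, hc₃0, fun X hX => ?_⟩
  -- unpack the largeness of `X`
  have hX2 : 2 ≤ X := (le_max_left _ _).trans hX
  have hX1 : 1 ≤ X := by linarith
  have hX0' : 0 < X := by linarith
  have hXK : 2 / K₀ ≤ X := ((le_max_left _ _).trans (le_max_right _ _)).trans hX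
  have hXℓ : Real.exp ℓ₀ ≤ X := ((le_max_right _ _).trans (le_max_right _ _)).trans hX
  set ℓ := Real.log X with hℓ
  have hℓℓ₀ : ℓ₀ ≤ ℓ := by rw [hℓ, ← Real.log_exp ℓ₀]; exact Real.log_le_log (Real.exp_pos _) hXℓ
  have hℓ48 : (4 : ℝ) ^ 8 ≤ ℓ := (le_max_left _ _).trans hℓℓ₀
  have hℓ324 : (324 : ℝ) ^ 2 ≤ ℓ := ((le_max_left _ _).trans (le_max_right _ _)).trans hℓℓ₀
  have hℓκ₁ : κ₁ + 1 ≤ ℓ := ((le_max_left _ _).trans ((le_max_right _ _).trans (le_max_right _ _))).trans hℓℓ₀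
  have hℓcq : 2 * |Real.log cq| + 1 ≤ ℓ :=
    ((le_max_left _ _).trans ((le_max_right _ _).trans ((le_max_right _ _).trans (le_max_right _ _)))).trans hℓℓ₀
  have hℓc₂ : Real.log c₂ + 1 ≤ ℓ :=
    ((le_max_right _ _).trans ((le_max_right _ _).trans ((le_max_right _ _).trans (le_max_right _ _)))).trans hℓℓ₀
  have hℓ1 : 1 ≤ ℓ := le_trans (by norm_num) hℓ48
  have hXexp : X = Real.exp ℓ := by rw [hℓ, Real.exp_log hX0']
  -- the box principle
  obtain ⟨v, hv, hhgt, hsmall⟩ := exists_small_periodForm L hX1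
  have hH1 : 1 ≤ hgt v := one_le_hgt hv
  have hH1' : (1 : ℝ) ≤ hgt v := by exact_mod_cast hH1
  -- (ii) upper
  have hHup : (hgt v : ℝ) < c₂ * X ^ 2 := by
    have e1 : (4 * W * X + 3) ^ 2 ≤ ((4 * W + 3) * X) ^ 2 :=
      pow_le_pow_left₀ (by positivity) (by linarith) 2
    have e2 : ((4 * W + 3) * X) ^ 2 + 1 < c₂ * X ^ 2 := by
      rw [hc₂]; have : (1 : ℝ) ≤ X ^ 2 := one_le_pow₀ hX1
      linarith
    linarith
  -- the triple is "complex": `C ≠ 0`, `B² - 4AC < 0`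
  have hsmall1 : ‖periodForm L v‖ < K₀ := by
    have : X⁻¹ ≤ K₀ / 2 := by
      rw [inv_le_comm₀ hX0' (by positivity)]
      calc (K₀ / 2)⁻¹ = 2 / K₀ := by rw [inv_div]
        _ ≤ X := hXK
    linarith
  have hcomplex : v.2.2 ≠ 0 ∧ v.2.1 ^ 2 - 4 * v.1 * v.2.2 < 0 := by
    by_contra hnc
    have h' : v.2.2 = 0 ∨ 0 ≤ v.2.1 ^ 2 - 4 * v.1 * v.2.2 := by
      by_cases hC : v.2.2 = 0
      · exact Or.inl hC
      · exact Or.inr (not_lt.mp (fun hlt => hnc ⟨hC, hlt⟩))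
    have := periodForm_ge_of_not_complex L hv h'
    linarith
  obtain ⟨hC, hdisc⟩ := hcomplex
  -- (ii) lower, by Theorem I at the root close to `τ`
  obtain ⟨Q, hQA, hQB, hQC, hQH, hclose⟩ := exists_close_root L hC hdisc
  have hQH' : ((Q.H : ℕ) : ℝ) = (hgt v : ℝ) := by exact_mod_cast hQH
  have hQdisc : Q.B ^ 2 - 4 * Q.A * Q.C < 0 := by rw [hQA, hQB, hQC]; exact hdisc
  have hT' := hT Q hQdisc
  rw [hQH'] at hT'
  have hlogH0 : 0 ≤ Real.log (hgt v : ℝ) := Real.log_nonneg hH1'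
  have hpf_lt : ‖periodForm L v‖ < Real.exp (-ℓ) := by rw [Real.exp_neg, ← hXexp]; exact hsmall
  have hHlow : Real.exp (ℓ ^ (1 / 4 : ℝ)) < hgt v := by
    by_contra hle
    push Not at hle
    have hlogle : Real.log (hgt v : ℝ) ≤ ℓ ^ (1 / 4 : ℝ) := by
      rw [← Real.log_exp (ℓ ^ (1 / 4 : ℝ))]; exact Real.log_le_log (by linarith) hle
    have h78 : Real.log (hgt v : ℝ) ^ (7 / 2 : ℝ) ≤ ℓ ^ (7 / 8 : ℝ) := by
      calc Real.log (hgt v : ℝ) ^ (7 / 2 : ℝ) ≤ (ℓ ^ (1 / 4 : ℝ)) ^ (7 / 2 : ℝ) :=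
            Real.rpow_le_rpow hlogH0 hlogle (by norm_num)
        _ = ℓ ^ (7 / 8 : ℝ) := by rw [← Real.rpow_mul (by linarith)]; norm_num
    have hℓ78 := rpow_seven_eighths_le hℓ48
    -- `c₁² |ω₁|² e^{-2ℓ^{7/8}} ≤ |ω₁|² |τ - α|² ≤ |form| < e^{-ℓ}`
    have h1 : c₁ * Real.exp (-ℓ ^ (7 / 8 : ℝ)) ≤ ‖τ - Q.α‖ :=
      le_trans (mul_le_mul_of_nonneg_left (Real.exp_le_exp.mpr (by linarith)) hc₁0.le) hT'
    have h2 : (c₁ * Real.exp (-ℓ ^ (7 / 8 : ℝ))) ^ 2 ≤ ‖τ - Q.α‖ ^ 2 := pow_le_pow_left₀ (by positivity) h1 2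
    have h3 : ‖L.ω₁‖ ^ 2 * (c₁ * Real.exp (-ℓ ^ (7 / 8 : ℝ))) ^ 2 < Real.exp (-ℓ) :=
      lt_of_le_of_lt ((mul_le_mul_of_nonneg_left h2 (by positivity)).trans hclose) hpf_lt
    have h4 : ‖L.ω₁‖ ^ 2 * (c₁ * Real.exp (-ℓ ^ (7 / 8 : ℝ))) ^ 2 =
        c₁ ^ 2 * ‖L.ω₁‖ ^ 2 * Real.exp (-(2 * ℓ ^ (7 / 8 : ℝ))) := by
      rw [show -(2 * ℓ ^ (7 / 8 : ℝ)) = -ℓ ^ (7 / 8 : ℝ) + -ℓ ^ (7 / 8 : ℝ) by ring, Real.exp_add]; ring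
    rw [h4] at h3
    have h5 : c₁ ^ 2 * ‖L.ω₁‖ ^ 2 < Real.exp (-(ℓ / 2)) := by
      have hpos : 0 < Real.exp (-(2 * ℓ ^ (7 / 8 : ℝ))) := Real.exp_pos _
      have := (lt_div_iff₀ hpos).mpr h3
      rw [← Real.exp_sub] at this
      exact this.trans_le (Real.exp_le_exp.mpr (by linarith))
    have hcω : 0 < c₁ ^ 2 * ‖L.ω₁‖ ^ 2 := by positivity
    have h6 : Real.exp (-(ℓ / 2)) < c₁ ^ 2 * ‖L.ω₁‖ ^ 2 := by
      rw [← Real.exp_log hcω]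
      refine Real.exp_lt_exp.mpr ?_
      have := neg_abs_le (Real.log (c₁ ^ 2 * ‖L.ω₁‖ ^ 2))
      rw [hκ₁] at hℓκ₁
      linarith
    linarith
  -- (i) lower, by `quadForm_lower`
  have hIlow : Real.exp (-ℓ ^ 4) < ‖periodForm L v‖ := by
    have hqv := hq v hv
    have hlogH : Real.log (hgt v : ℝ) ≤ 3 * ℓ := by
      have h1 : Real.log (hgt v : ℝ) ≤ Real.log (c₂ * X ^ 2) := Real.log_le_log (by linarith) hHup.le
      rw [Real.log_mul (by positivity) (by positivity), Real.log_pow, ← hℓ] at h1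
      push_cast at h1
      linarith
    have h72 : 2 * Real.log (hgt v : ℝ) ^ (7 / 2 : ℝ) ≤ ℓ ^ 4 / 2 := by
      have e1 : Real.log (hgt v : ℝ) ^ (7 / 2 : ℝ) ≤ (3 * ℓ) ^ (7 / 2 : ℝ) :=
        Real.rpow_le_rpow hlogH0 hlogH (by norm_num)
      have e2 := rpow_three_mul_le (by linarith : (0 : ℝ) ≤ ℓ)
      have e3 := rpow_seven_halves_le hℓ324
      linarith
    have hcq : Real.exp (-|Real.log cq|) ≤ cq := by
      conv_rhs => rw [← Real.exp_log hcq0]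
      exact Real.exp_le_exp.mpr (neg_abs_le _)
    have hℓ4 : ℓ ≤ ℓ ^ 4 := le_self_pow₀ hℓ1 (by norm_num)
    calc Real.exp (-ℓ ^ 4) < Real.exp (-|Real.log cq|) * Real.exp (-(ℓ ^ 4 / 2)) := by
          rw [← Real.exp_add]; exact Real.exp_lt_exp.mpr (by linarith)
      _ ≤ cq * Real.exp (-2 * Real.log (hgt v : ℝ) ^ (7 / 2 : ℝ)) :=
          mul_le_mul hcq (Real.exp_le_exp.mpr (by linarith)) (Real.exp_nonneg _) hcq0.le
      _ ≤ ‖periodForm L v‖ := hqv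
  -- (iii)
  have hIII : c₃ * hgt v < |(v.2.2 : ℝ)| := h3 v hC (hsmall.trans_le (inv_le_one_of_one_le₀ hX1))
  refine ⟨v, hv, ?_, hsmall, ?_, hHup, hIII⟩
  · rw [hℓ] at hIlow; exact hIlow
  · rw [hℓ] at hHlow; exact hHlow

end Lemma22

end Literature.NumberTheory.Transcendental.Masser1975
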